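import Summits.QuantumFields.YangMills.Theorems.UnitScaleTiltProp7HessWOfFibreCoreT3Rows
import Literature.MathematicalPhysics.QuantumFieldTheory.Balaban1983to89.B7Prop6Flat
import HarnessLib

/-!
# Route `UnitScaleTilt`, crux K1 child «MinimiserStabilityRegPr» (stmt-QuantumFields-19200), route-R E′ path (α′) — THE CURVED-JUNCTION LETTERS, (J-a):
# Ad-COVARIANCE OF THE DOOR's LETTERS UNDER A SIMULTANEOUS GAUGE CHANGE OF THE PAIR `(W, Y) ↦ (W^σ, Y^σ)`:
# the chart `(Y^σ)_b(W^σ)_b⁻¹ = σ(b₋)·(Y_bW_b⁻¹)·σ(b₋)⁻¹`, its Hermitian logarithm, and the covariant divergence `D^*_{W^σ}(Ad_σA) = Ad_σ(D^*_W A)`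

Cell `ym3-torus` ∕ width seat `ym-ust-19200-w1` (gen 11; pen «w1: J-letters GO», ★p1 g14 2026-08-28 17:33Z; sibling of `…Prop7CurvedJunctionLetters` (J-b)(J-c)).
THEOREMS ONLY (0 `def`, 0 `sorry`); `--supports stmt-QuantumFields-19200`, count-neutral.  YM₃ on T³ is a ladder rung (R3), not the Clay problem; nothing here claims
the stub, the crux, d = 4 or the mass gap.

WHY.  The path-(α) doors (✓`Prop7LocMinOfPinnedChartSlice.*`) fix the background `W` and read `DIV_W(D)`, `K_W(D)`, `M(D)` of the chart `D = (−i)log(Y_bW_b⁻¹)` of a fibre point `Y`.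
A covariant re-run of the flat `S_H` rows (LOCATE memo `LOCATE-CURVED-JUNCTION-w1g11.md` §1) wants to compute these in a convenient gauge of the PAIR (e.g. W's comb axial gauge
on a cell, where `‖W^σ_b − 1‖ ≤ 3e·L^{−(K−n)}` and the (J-b) rows of the sibling file apply).  This file certifies that nothing changes: under `(W, Y) ↦ (W^σ, Y^σ)` the chart is
conjugated AT THE SOURCE SITE, its Hermitian logarithm likewise ([B7] `mlog_conj`), its norm is unchanged, and the door's covariant divergence of a source-conjugated bond field is
the conjugated divergence — so `DIV`, `M` (and, by the same token, `K`) are gauge invariants of the pair.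

WHAT IS PROVED (ns `…Theorems.Prop7CurvedJunctionCovariance`).  `gaugeAct_mul_inv_gaugeAct` (group level), `coe_chart_gaugeAct` (matrix level), `mlog_conj_SU`, ★`hermLog_chart_gaugeAct`
(the Hermitian-log chart is `Ad_{σ(b₋)}`-conjugated), `norm_hermLog_chart_gaugeAct` (hence `M` invariant), ★★`divB_gaugeAct_conj` (`D^*_{W^σ}(Ad_σA)(x) = σ(x)·(D^*_WA)(x)·σ(x)*`).

HONEST SCOPE.  Algebra only; the four-term linearised plaquette's covariance (`K`) is the same computation term by term and is left to the consumer's `simp` (not typed here).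

References: T. Bałaban, CMP 99 (1985) 389–434 [Balaban1985BackgroundPropagators] ((3.3)–(3.9) pp.390–392, gauge covariance p.393); CMP 98 (1985) 17–51
[Balaban1985Averaging] ((11)–(13) p.19, (19)–(21) p.21); CMP 102 (1985) 277–309 [Balaban1985Variational] ((4) p.278, (15) p.280).
-/

noncomputable section

open scoped BigOperators Matrix.Norms.L2Operator Matrix

namespace Summit.QuantumFields.YangMills.Theorems.Prop7CurvedJunctionCovariance

open NormedSpace
open Literature.MathematicalPhysics.QuantumFieldTheory.Balaban1983to89
open Literature.MathematicalPhysics.QuantumFieldTheory.Balaban1983to89.T3ContinuumYM3Torus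
open Finset T4Continuum
open B9Eq39Adjoint (divB)
open B10Eq27TorusAxialLog (unitsField toUField)
open B9TorusCalculus (torusT)
open MatrixLog (mlog)
open Summit.QuantumFields.YangMills.Theorems.Prop7PointLandauDivergence (divB_apply)
open Summit.QuantumFields.YangMills.Theorems.PerturbedPlaquette (norm_conj_SU)

/-! ## §1 The chart under a simultaneous gauge change -/

section Chart

variable {P : Params} {j : ℕ} {G : Type*} [GaugeGroup G]

/-- `(Y^σ)_b·((W^σ)_b)⁻¹ = σ(b₋)·(Y_b·W_b⁻¹)·σ(b₋)⁻¹` — the relative bond variable is conjugated at the source site. [cite: Balaban1985Variational, (4) p.278, (15) p.280] -/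
theorem gaugeAct_mul_inv_gaugeAct (σ : GaugeTransf P j G) (Y W : GaugeField P j G) (b : PBond P j) :
    GaugeField.gaugeAct σ Y b * (GaugeField.gaugeAct σ W b)⁻¹ = σ b.src * (Y b * (W b)⁻¹) * (σ b.src)⁻¹ := by
  show σ b.src * Y b * (σ b.tgt)⁻¹ * (σ b.src * W b * (σ b.tgt)⁻¹)⁻¹ = _
  group

end Chart

section Matrices


/-- `log(gQg*) = g·log Q·g*` for `g ∈ SU` ([B7] `mlog_conj`, no side condition). [cite: Balaban1985Averaging, (19)-(21) p.21] -/
theorem mlog_conj_SU {m : Type*} [Fintype m] [DecidableEq m] (g : Matrix.specialUnitaryGroup m ℂ) (Q : Matrix m m ℂ) :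
    mlog ((g : Matrix m m ℂ) * Q * star (g : Matrix m m ℂ)) = (g : Matrix m m ℂ) * mlog Q * star (g : Matrix m m ℂ) := by
  have hg := Matrix.mem_unitaryGroup_iff.mp g.2.1
  have hg' := Matrix.mem_unitaryGroup_iff'.mp g.2.1
  let u : (Matrix m m ℂ)ˣ := ⟨(g : Matrix m m ℂ), star (g : Matrix m m ℂ), hg, hg'⟩
  have h := B7Prop6Flat.mlog_conj u Q
  exact h

variable {P : Params} {j : ℕ}

/-- THE MATRIX READING of `gaugeAct_mul_inv_gaugeAct`: `↑((Y^σ)_b((W^σ)_b)⁻¹) = ↑σ(b₋)·↑(Y_bW_b⁻¹)·(↑σ(b₋))*`. [cite: Balaban1985Variational, (15) p.280] -/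
theorem coe_chart_gaugeAct (σ : GaugeTransf P j (Matrix.specialUnitaryGroup (Fin 2) ℂ)) (Y W : GaugeField P j (Matrix.specialUnitaryGroup (Fin 2) ℂ)) (b : PBond P j) :
    ((GaugeField.gaugeAct σ Y b * (GaugeField.gaugeAct σ W b)⁻¹ : Matrix.specialUnitaryGroup (Fin 2) ℂ) : Matrix (Fin 2) (Fin 2) ℂ)
      = (σ b.src : Matrix (Fin 2) (Fin 2) ℂ) * ((Y b * (W b)⁻¹ : Matrix.specialUnitaryGroup (Fin 2) ℂ) : Matrix (Fin 2) (Fin 2) ℂ) * star (σ b.src : Matrix (Fin 2) (Fin 2) ℂ) := by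
  rw [gaugeAct_mul_inv_gaugeAct, Submonoid.coe_mul, Submonoid.coe_mul, ← Matrix.star_eq_inv]
  rfl

/-- ★ **THE HERMITIAN-LOG CHART IS `Ad_{σ(b₋)}`-CONJUGATED**: `(−i)log ↑((Y^σ)_b((W^σ)_b)⁻¹) = σ(b₋)·((−i)log ↑(Y_bW_b⁻¹))·σ(b₋)*`.
[cite: Balaban1985Variational, (15) p.280; Balaban1985Averaging, (19)-(21) p.21] -/
theorem hermLog_chart_gaugeAct (σ : GaugeTransf P j (Matrix.specialUnitaryGroup (Fin 2) ℂ)) (Y W : GaugeField P j (Matrix.specialUnitaryGroup (Fin 2) ℂ)) (b : PBond P j) :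
    (-Complex.I) • mlog (((GaugeField.gaugeAct σ Y b * (GaugeField.gaugeAct σ W b)⁻¹ : Matrix.specialUnitaryGroup (Fin 2) ℂ) : Matrix (Fin 2) (Fin 2) ℂ))
      = (σ b.src : Matrix (Fin 2) (Fin 2) ℂ) * ((-Complex.I) • mlog (((Y b * (W b)⁻¹ : Matrix.specialUnitaryGroup (Fin 2) ℂ) : Matrix (Fin 2) (Fin 2) ℂ))) * star (σ b.src : Matrix (Fin 2) (Fin 2) ℂ) := by
  rw [coe_chart_gaugeAct, mlog_conj_SU, mul_smul_comm, smul_mul_assoc]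

/-- Hence the chart's bond norms (the door's `M`) are invariants of the pair. [cite: Balaban1985Averaging, (19) p.21] -/
theorem norm_hermLog_chart_gaugeAct (σ : GaugeTransf P j (Matrix.specialUnitaryGroup (Fin 2) ℂ)) (Y W : GaugeField P j (Matrix.specialUnitaryGroup (Fin 2) ℂ)) (b : PBond P j) :
    ‖(-Complex.I) • mlog (((GaugeField.gaugeAct σ Y b * (GaugeField.gaugeAct σ W b)⁻¹ : Matrix.specialUnitaryGroup (Fin 2) ℂ) : Matrix (Fin 2) (Fin 2) ℂ))‖
      = ‖(-Complex.I) • mlog (((Y b * (W b)⁻¹ : Matrix.specialUnitaryGroup (Fin 2) ℂ) : Matrix (Fin 2) (Fin 2) ℂ))‖ := by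
  rw [hermLog_chart_gaugeAct, norm_conj_SU]

end Matrices

/-! ## §2 The door's covariant divergence under a simultaneous gauge change -/

section Divergence

variable {F : T3Family} {K : ℕ}

/-- ★★ **`D^*_{W^σ}(Ad_σA)(x) = σ(x)·(D^*_W A)(x)·σ(x)*`** for the DOOR's covariant divergence `divB (torusT …) (unitsField (toUField ·))` and a bond field conjugated at
its source site, `(Ad_σA)_κ(z) = σ(z)·A_κ(z)·σ(z)*`. [cite: Balaban1985BackgroundPropagators, (3.8) p.392, p.393] -/
theorem divB_gaugeAct_conj (σ : GaugeTransf (F.P K) 0 (Matrix.specialUnitaryGroup (Fin 2) ℂ)) (W : GaugeField (F.P K) 0 (Matrix.specialUnitaryGroup (Fin 2) ℂ))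
    (A : Fin (F.P K).d → Site (F.P K) 0 → Matrix (Fin 2) (Fin 2) ℂ) (x : Site (F.P K) 0) :
    divB (torusT (F.P K) 0) (fun κ z => unitsField (toUField (GaugeField.gaugeAct σ W)) ⟨z, κ⟩)
        (fun κ z => (σ z : Matrix (Fin 2) (Fin 2) ℂ) * A κ z * star (σ z : Matrix (Fin 2) (Fin 2) ℂ)) x
      = (σ x : Matrix (Fin 2) (Fin 2) ℂ) * divB (torusT (F.P K) 0) (fun κ z => unitsField (toUField W) ⟨z, κ⟩) A x * star (σ x : Matrix (Fin 2) (Fin 2) ℂ) := by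
  rw [divB_apply, divB_apply, Finset.mul_sum, Finset.sum_mul]
  refine Finset.sum_congr rfl fun μ _ => ?_
  -- the gauged bond variable on `⟨x − e_μ, μ⟩`: `σ(x−e_μ)·W·σ(x)⁻¹`
  have hb : ((GaugeField.gaugeAct σ W ⟨x.unshift μ, μ⟩ : Matrix.specialUnitaryGroup (Fin 2) ℂ) : Matrix (Fin 2) (Fin 2) ℂ)
      = (σ (x.unshift μ) : Matrix (Fin 2) (Fin 2) ℂ) * (W ⟨x.unshift μ, μ⟩ : Matrix (Fin 2) (Fin 2) ℂ) * star (σ x : Matrix (Fin 2) (Fin 2) ℂ) := by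
    show (((σ (x.unshift μ) * W ⟨x.unshift μ, μ⟩ * (σ (PBond.tgt ⟨x.unshift μ, μ⟩))⁻¹ : Matrix.specialUnitaryGroup (Fin 2) ℂ)) : Matrix (Fin 2) (Fin 2) ℂ) = _
    rw [show PBond.tgt (⟨x.unshift μ, μ⟩ : PBond (F.P K) 0) = x from B10StarCount.shift_unshift x μ, Submonoid.coe_mul, Submonoid.coe_mul, ← Matrix.star_eq_inv]
    rfl
  have hσ : star (σ (x.unshift μ) : Matrix (Fin 2) (Fin 2) ℂ) * (σ (x.unshift μ) : Matrix (Fin 2) (Fin 2) ℂ) = 1 :=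
    Matrix.mem_unitaryGroup_iff'.mp (σ (x.unshift μ)).2.1
  rw [hb]
  set s₀ : Matrix (Fin 2) (Fin 2) ℂ := (σ (x.unshift μ) : Matrix (Fin 2) (Fin 2) ℂ)
  set s₁ : Matrix (Fin 2) (Fin 2) ℂ := (σ x : Matrix (Fin 2) (Fin 2) ℂ)
  set w : Matrix (Fin 2) (Fin 2) ℂ := (W ⟨x.unshift μ, μ⟩ : Matrix (Fin 2) (Fin 2) ℂ)
  set a₀ := A μ (x.unshift μ)
  set a₁ := A μ x
  rw [star_mul, star_mul, star_star]
  -- `(s₁ w* s₀*)·(s₀ a₀ s₀*)·(s₀ w s₁*) − s₁ a₁ s₁* = s₁ (w* a₀ w − a₁) s₁*`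
  have e1 : s₁ * (star w * star s₀) * (s₀ * a₀ * star s₀) * (s₀ * w * star s₁)
      = s₁ * (star w * (star s₀ * s₀) * a₀ * (star s₀ * s₀) * w) * star s₁ := by noncomm_ring
  rw [e1, hσ]
  noncomm_ring

end Divergence

end Summit.QuantumFields.YangMills.Theorems.Prop7CurvedJunctionCovariance

end
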